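import Summits.BirchSwinnertonDyer.BirchSwinnertonDyer.Theorems.KolyvaginRankRigidityAtTwoRegularRefillLawGeneral
import HarnessLib

/-!
# Crux U1 `KolyvaginBoundedDefectAtTwo` (stmt-BirchSwinnertonDyer-28083), LINE 17 `regular_core_rigidity` v3,
# stub S1b `stub_nearCoreExistenceAtTwo` — the SIGN OF THE REFILL: under an involution `σ` preserving the pairing and
# the Lagrangian pair, `ann_{H_tr}(H_f^{σ = s}) ⊆ H_tr^{σ = −s}`; hence the refill of a pure `s`-step is a
# `(−s)`-eigenclass up to the defect of the cut

Width seat `bsd-line-krr2-p2` g14 (ONE READER on S1b); `--supports stmt-BirchSwinnertonDyer-28083` (helper). THEOREMS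
ONLY (abstract finite-group algebra in g13's setting); nothing here proves S1b, U1, a rung or BSD. BSD is NOT proved.

## Why
The walk of S1b (reader report S1-READER-g14 §4, frame invariant in the seat's NOTES) needs, after a PURE step of sign
`s` (the cut `A = X ∩ H_f` contains `2^c · H_f^{σ=s}`, `σ = conjActPlace` the complex conjugation on `H¹(K_λ, E[2^k])`),
that the REFILL `B = X ∩ H_tr` is a `(−s)`-eigen-subgroup up to `2^c`: then the new frame element `(1 − sτ) r` has the
opposite sign and the next step is a good (`𝔪`-type) cut. Counting alone cannot decide the sign. This file proves
it from ONE extra property of the local pairing — INVARIANCE under `σ`, `⟨σx, σy⟩ = ⟨x, y⟩` (in situ: the tree's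
`localTatePairingZMod_conjActPlace` with the PROVED conjugation-compatibility of the canonical invariant maps,
`poitouTate_selmerStructure_duality_conj_holds`, and `map_weilDual_conjActPlace` for a lift-equivariant Weil datum):
* `apply_add_smul_eq_zero_of_mem_ann` — for `t ∈ ann_{H_tr}(H_f ∩ ker(σ − s))`: `σ t + s t = 0` (the key: `(σ + s) f`
  is always an `s`-eigenvector of `H_f`, so `⟨f, σt + st⟩ = ⟨(σ + s) f, t⟩ = 0`, and `H_f × H_tr` is perfect);
* `nsmul_add_smul_eq_zero_of_cut` — if `2^c · (H_f ∩ ker(σ − s)) ⊆ A` and `t ∈ ann_{H_tr}(A)` then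
  `2^c (σ t + s t) = 0`;
* `nsmul_add_smul_eq_zero_of_mem_lagrangian` — the same for every `t ∈ X ∩ H_tr` when `X` is isotropic
  (`B ⊆ ann(A)`): THE REFILL OF A PURE `s`-STEP IS `(−s)`-EIGEN UP TO `2^c`.
References (locators only; no cited FACT is declared): [cite: MazurRubin2004, Prop. 1.3.2, §4.1]
[cite: Jetchev2008, §3.2 (2), Lemma 5.2 (iii)] [cite: GrossLMS1991, §3 (3.3)] [cite: MilneADT2006, Ch. I §0 (0.19)].
Design: no definitions; `Type*`-polymorphic; axioms `propext`, `Classical.choice`, `Quot.sound`.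
-/

set_option autoImplicit false
-- the Theorems namespace of this sub repeats the summit name by design (D-0017 nested layout)
set_option linter.dupNamespace false

noncomputable section

open scoped Classical
open Function

namespace Summit.BirchSwinnertonDyer.BirchSwinnertonDyer.Theorems.KolyvaginAtTwo.RegularRefill

variable {L : Type*} [AddCommGroup L]

section Sign

variable {n : ℕ} (b : L →+ L →+ ZMod n)
  (hsymm : ∀ x y, b x y = b y x)
  {Hf Htr : AddSubgroup L} (hcod : Hf ⊔ Htr = ⊤)
  (hHtr : ∀ x ∈ Htr, ∀ y ∈ Htr, b x y = 0)
  (σ : L →+ L) (hσσ : ∀ x, σ (σ x) = x) (hσb : ∀ x y, b (σ x) (σ y) = b x y)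
  (hσf : ∀ f ∈ Hf, σ f ∈ Hf) (hσt : ∀ t ∈ Htr, σ t ∈ Htr)
  {s : ℤ} (hs : s = 1 ∨ s = -1)

include hsymm hcod hHtr hσσ hσb hσf hσt hs in
/-- **`ann_{H_tr}(H_f^{σ = s}) ⊆ H_tr^{σ = −s}`.** `b` symmetric with `H_f × H_tr` perfect (non-degenerate, `H_f + H_tr = L`,
`H_tr` isotropic), `σ` an involution preserving `b`, `H_f` and `H_tr`, `s = ±1`. If `t ∈ H_tr` pairs to zero with every
`f ∈ H_f` with `σ f = s f`, then `σ t + s t = 0`. PROOF: for `f ∈ H_f`, `(σ + s) f ∈ H_f` is `σ`-eigen with eigenvalue `s`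
(`σ(σ f + s f) = f + s σ f = s (σ f + s f)`), so `0 = ⟨σ f + s f, t⟩ = ⟨σ f, t⟩ + s⟨f, t⟩ = ⟨f, σ t⟩ + s ⟨f, t⟩ = ⟨f, σ t + s t⟩`
(invariance and `σ² = 1`); conclude by perfectness. [cite: GrossLMS1991, §3 (3.3)] [cite: MazurRubin2004, Prop. 1.3.2] -/
theorem apply_add_smul_eq_zero_of_mem_ann (hinj : Injective b) {t : L} (ht : t ∈ Htr)
    (hann : ∀ f ∈ Hf, σ f = s • f → b f t = 0) : σ t + s • t = 0 := by
  have hmem : σ t + s • t ∈ Htr := Htr.add_mem (hσt t ht) (Htr.zsmul_mem ht s)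
  refine eq_zero_of_mem_of_forall_mem' b hsymm hcod hHtr hinj hmem fun f hf ↦ ?_
  have hss : s * s = 1 := by rcases hs with rfl | rfl <;> norm_num
  -- `(σ + s) f` is an `s`-eigenvector in `H_f`
  have heig : σ (σ f + s • f) = s • (σ f + s • f) := by
    rw [map_add, map_zsmul, hσσ, smul_add, smul_smul, hss, one_smul, add_comm]
  have hmemf : σ f + s • f ∈ Hf := Hf.add_mem (hσf f hf) (Hf.zsmul_mem hf s)
  have h0 : b (σ f + s • f) t = 0 := hann _ hmemf heig
  -- `⟨σ f, t⟩ = ⟨f, σ t⟩`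
  have h1 : b (σ f) t = b f (σ t) := by
    conv_lhs => rw [← hσσ t]
    rw [hσb]
  rw [map_add, map_zsmul, AddMonoidHom.add_apply, AddMonoidHom.zsmul_apply, h1] at h0
  rw [map_add, map_zsmul]
  exact h0

include hsymm hcod hHtr hσσ hσb hσf hσt hs in
/-- **The refill of a cut containing `2^c · H_f^{σ=s}` is `(−s)`-eigen up to `2^c`.** If `A ≤ L` contains `2^c • f` for
every `s`-eigenvector `f ∈ H_f`, and `t ∈ H_tr` pairs to zero with `A`, then `2^c • (σ t + s t) = 0`.
[cite: MazurRubin2004, Prop. 1.3.2, §4.1] [cite: Jetchev2008, Lemma 5.2 (iii)] -/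
theorem nsmul_add_smul_eq_zero_of_cut (hinj : Injective b) (A : AddSubgroup L) (c : ℕ)
    (hcut : ∀ f ∈ Hf, σ f = s • f → (2 ^ c) • f ∈ A)
    {t : L} (ht : t ∈ Htr) (hann : ∀ a ∈ A, b a t = 0) :
    (2 ^ c) • (σ t + s • t) = 0 := by
  have ht' : (2 ^ c) • t ∈ Htr := Htr.nsmul_mem ht _
  have h := apply_add_smul_eq_zero_of_mem_ann b hsymm hcod hHtr σ hσσ hσb hσf hσt hs hinj ht' fun f hf hfe ↦ by
    rw [map_nsmul, ← AddMonoidHom.nsmul_apply, ← map_nsmul]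
    exact hann _ (hcut f hf hfe)
  rw [map_nsmul, smul_comm] at h
  rw [smul_add]
  exact h

include hsymm hcod hHtr hσσ hσb hσf hσt hs in
/-- **THE SIGN OF THE REFILL.** `X ≤ L` isotropic (`⟨X, X⟩ = 0`), `2^c · H_f^{σ = s} ⊆ X` (the pure `s`-cut, up to the
defect `c`): every `t ∈ X ∩ H_tr` has `2^c (σ t + s t) = 0` — the refill `X ∩ H_tr` is a `(−s)`-eigen-subgroup up to
`2^c`. [cite: MazurRubin2004, Prop. 1.3.2, §4.1] [cite: Jetchev2008, §3.2 (2), Lemma 5.2 (iii)] -/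
theorem nsmul_add_smul_eq_zero_of_mem_lagrangian (hinj : Injective b) (X : AddSubgroup L)
    (hX : ∀ x ∈ X, ∀ y ∈ X, b x y = 0) (c : ℕ)
    (hcut : ∀ f ∈ Hf, σ f = s • f → (2 ^ c) • f ∈ X)
    {t : L} (ht : t ∈ X ⊓ Htr) :
    (2 ^ c) • (σ t + s • t) = 0 :=
  nsmul_add_smul_eq_zero_of_cut b hsymm hcod hHtr σ hσσ hσb hσf hσt hs hinj X c hcut (AddSubgroup.mem_inf.mp ht).2
    fun a ha ↦ hX a ha t (AddSubgroup.mem_inf.mp ht).1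

end Sign

end Summit.BirchSwinnertonDyer.BirchSwinnertonDyer.Theorems.KolyvaginAtTwo.RegularRefill

end
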